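import Literature.NumberTheory.Transcendental.ZeroEstDerivatives
import Literature.NumberTheory.Transcendental.ZeroEstNullstellensatz
import Mathlib.LinearAlgebra.Matrix.Adjugate
import Mathlib.LinearAlgebra.Matrix.NonsingularInverse
import Mathlib.LinearAlgebra.Dual.Lemmas
import HarnessLib

/-!
# Zero estimates on commutative algebraic groups, XIII: the transversal family (Prop. 3.8, Step 2)

Topic `Literature/NumberTheory/Transcendental`. Thirteenth module of the discharge of
`Literature.NumberTheory.Transcendental.philippon1986_std` through D. Roy's exposition of
Philippon's zero estimate (Nesterenko–Philippon (eds.), LNM 1752, Ch. 11, Prop. 3.8, Step 2,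
pp. 216–217) for an abstract analytic group model `M : AnalyticGroupModel V N`.

Let `𝔭 ⊇ 𝔊` be a relevant homogeneous prime with zero set `Z = Z_G(𝔭)`, homogeneous under the
differences of its points (`∀ w v ∈ Z, v + (w - σ) ∈ Z`, as for a translate `σ + H₀` of a
subgroup), `σ ∈ Z` a point with `Θ_{J₀}(σ) ≠ 0`, and `x_1, …, x_s` linearly independent vectors
whose span meets the **lineality space** `𝒯(Z) = {x ; Z + ℂx ⊆ Z}` (`linSpace`) only in `0`.
Then (`exists_transversal`) there are `G_1, …, G_s ∈ 𝔭` with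
`𝒟_{x_i} G_j ∈ 𝔭` for `i ≠ j` and `𝒟_{x_i} G_i ∉ 𝔭` (chart derivations `𝒟 = chartDer J₀`).

Roy obtains `f_j` with `det (∂^{e_i} f_j(σ)) ≠ 0` from `W₁ ∩ T_H = 0` with `T_H` the (Zariski)
tangent space. We replace the tangent space by the lineality space and argue as follows
(`lineDeriv_eq_zero_on_zeroSet`, `mem_linSpace_of_forall_lineDeriv`): if a direction `x₀` in the
span kills all `∂_{x₀}F_A(σ)`, `A ∈ 𝔭` homogeneous, then translating by the differences of points
(`translForm`) it kills `∂_{x₀}F_A` at every point of `Z`, so every `𝒟_{J,x₀}A ∈ 𝔍(Z) = 𝔭`,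
hence all iterates `𝒟^k_{J,x₀}A ∈ 𝔭`, so all `t`-derivatives of `F_A(w + t x₀)/Θ_J(w + t x₀)^D`
vanish (`F_chartDer_iterate`) and `F_A(w + t x₀) ≡ 0`: `Z + ℂx₀ ⊆ Z`, `x₀ ∈ 𝒯(Z)`, `x₀ = 0`.
Hence the vectors `(F_{𝒟_{x_i}A}(σ))_i` span `ℂ^s`, a basis of them gives forms `A_j ∈ 𝔭` with
`det(F_{𝒟_{x_i}A_j}(σ)) ≠ 0`, and Roy's cofactor construction (94) `G_k = ∑_j adj(𝕄)_{kj} A_j`,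
`𝕄_{ji} = 𝒟_{x_i}A_j`, concludes (`Matrix.adjugate_mul`). No smoothness of `Z` is used.

Everything is PROVED; no named facts.

## References

* Yu. V. Nesterenko, P. Philippon (eds.), *Introduction to Algebraic Independence Theory*,
  LNM 1752, Springer 2001, Ch. 11 (D. Roy), Prop. 3.8, Step 2 (pp. 216–217). [NesterenkoPhilippon2001]
* P. Philippon, *Lemmes de zéros dans les groupes algébriques commutatifs*, Bull. Soc. Math.
  France 114 (1986), 355–383, Lemme 4.5. [Philippon1986]
-/

noncomputable section

open MvPolynomial Set Filter Topology Module
open scoped Pointwise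

namespace Literature.NumberTheory.Transcendental

namespace AnalyticGroupModel

variable {V : Type*} [NormedAddCommGroup V] [NormedSpace ℂ V] {N : ℕ} (M : AnalyticGroupModel V N)

attribute [local instance] MvPolynomial.gradedAlgebra

/-! ### The lineality space -/

omit M in
/-- **The lineality space** `𝒯(X) = {x ; X + ℂ x ⊆ X}` of a subset of `V` (for the preimage of an
algebraic subgroup: its Lie algebra). [folklore] -/
def linSpace (X : Set V) : Submodule ℂ V where
  carrier := {x | ∀ v ∈ X, ∀ t : ℂ, v + t • x ∈ X}
  zero_mem' := fun v hv t => by simpa using hv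
  add_mem' := by
    intro x y hx hy v hv t
    have := hy (v + t • x) (hx v hv t) t
    rwa [smul_add, ← add_assoc]
  smul_mem' := by
    intro c x hx v hv t
    have := hx v hv (t * c)
    rw [smul_smul]
    exact this

omit M in
/-- Membership in `𝒯(X)`. [folklore] -/
theorem mem_linSpace_iff {X : Set V} {x : V} : x ∈ linSpace X ↔ ∀ v ∈ X, ∀ t : ℂ, v + t • x ∈ X := Iff.rfl

omit M in
/-- The lineality space is invariant under translation. [folklore] -/
theorem linSpace_vadd (a : V) (X : Set V) : linSpace (a +ᵥ X) = linSpace X := by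
  ext x
  simp only [mem_linSpace_iff, Set.mem_vadd_set, vadd_eq_add]
  constructor
  · rintro h v hv t
    obtain ⟨v', hv', he⟩ := h (a + v) ⟨v, hv, rfl⟩ t
    have : v' = v + t • x := by
      have := congrArg (fun z => -a + z) he
      simpa [add_assoc] using this
    rwa [this] at hv'
  · rintro h _ ⟨v, hv, rfl⟩ t
    exact ⟨v + t • x, h v hv t, by rw [add_assoc]⟩

omit M in
/-- `X + 𝒯(X) ⊆ X`. [folklore] -/
theorem add_mem_of_mem_linSpace {X : Set V} {v x : V} (hv : v ∈ X) (hx : x ∈ linSpace X) : v + x ∈ X := by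
  simpa using hx v hv 1

/-! ### Zero sets of homogeneous ideals -/

/-- For a homogeneous ideal, `a ∈ Z_G(I)` iff all FORMS of `I` vanish at `a`. [folklore] -/
theorem mem_zeroSet_iff_forall_isHomogeneous {I : Ideal (MvPolynomial (Fin (N + 1)) ℂ)}
    (hI : I.IsHomogeneous (homogeneousSubmodule (Fin (N + 1)) ℂ)) {a : V} :
    a ∈ M.zeroSet (I : Set (MvPolynomial (Fin (N + 1)) ℂ)) ↔
      ∀ P ∈ I, ∀ d, P.IsHomogeneous d → M.F P a = 0 := by
  classical
  constructor
  · intro h P hP d _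
    have := h P hP 1
    rwa [one_smul] at this
  · intro h P hP c
    rw [← sum_homogeneousComponent P, map_sum]
    refine Finset.sum_eq_zero fun e _ => ?_
    have he : homogeneousComponent e P ∈ I := by
      have := hI e hP
      rwa [← DirectSum.Decomposition.decompose'_eq, decomposition.decompose'_apply] at this
    rw [M.eval_smul_pt (homogeneousComponent_isHomogeneous e P), h _ he e (homogeneousComponent_isHomogeneous e P),
      mul_zero]

/-- Members of `I` vanish on `Z_G(I)`. [folklore] -/
theorem F_eq_zero_of_mem_of_mem_zeroSet {I : Ideal (MvPolynomial (Fin (N + 1)) ℂ)} {P : MvPolynomial (Fin (N + 1)) ℂ}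
    (hP : P ∈ I) {a : V} (ha : a ∈ M.zeroSet (I : Set (MvPolynomial (Fin (N + 1)) ℂ))) : M.F P a = 0 := by
  have := ha P hP 1
  rwa [one_smul] at this

/-- Iterates of a chart derivation raise the degree. [folklore] -/
theorem isHomogeneous_iterate_chartDer (J₀ : Fin (N + 1)) (y : V) (k : ℕ) {Q : MvPolynomial (Fin (N + 1)) ℂ} {D : ℕ}
    (hQ : Q.IsHomogeneous D) : ((M.chartDer J₀ y)^[k] Q).IsHomogeneous (D + k) := by
  induction k with
  | zero => simpa using hQ
  | succ k ih =>
    rw [Function.iterate_succ_apply', ← add_assoc]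
    exact M.isHomogeneous_chartDer J₀ y ih

/-! ### Linearity of the chart derivations in the direction, at the level of functions -/

/-- `F_{𝒟_{J₀, ∑ cᵢ yᵢ} A} = ∑ cᵢ F_{𝒟_{J₀,yᵢ} A}`. [folklore] -/
theorem F_chartDer_sum_smul (J₀ : Fin (N + 1)) {ι : Type*} (S : Finset ι) (c : ι → ℂ) (y : ι → V)
    {A : MvPolynomial (Fin (N + 1)) ℂ} {D : ℕ} (hA : A.IsHomogeneous D) (w : V) :
    M.F (M.chartDer J₀ (∑ i ∈ S, c i • y i) A) w = ∑ i ∈ S, c i * M.F (M.chartDer J₀ (y i) A) w := by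
  have hdA : DifferentiableAt ℂ (M.F A) w := ((M.analyticOnNhd_F A) w trivial).differentiableAt
  have hdΘ : DifferentiableAt ℂ (M.Θ J₀) w := ((M.analyticOnNhd_Θ J₀) w trivial).differentiableAt
  simp only [M.F_chartDer J₀ _ hA, hdA.lineDeriv_eq_fderiv, hdΘ.lineDeriv_eq_fderiv, map_sum, map_smul,
    smul_eq_mul]
  rw [Finset.mul_sum, Finset.mul_sum, ← Finset.sum_sub_distrib]
  refine Finset.sum_congr rfl fun i _ => ?_
  ring

/-! ### Directions killing all derivatives of `𝔭` -/

section Step2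

variable {𝔭 : Ideal (MvPolynomial (Fin (N + 1)) ℂ)} [h𝔭 : 𝔭.IsPrime]
  (hhom : 𝔭.IsHomogeneous (homogeneousSubmodule (Fin (N + 1)) ℂ)) (h𝔊 : M.relIdeal ≤ 𝔭) (hrel : M.IsRelevant 𝔭)

include hhom h𝔊 hrel in
/-- A form vanishing on `Z_G(𝔭)` lies in `𝔭`. [folklore] -/
theorem mem_of_forall_F_eq_zero_on_zeroSet {A : MvPolynomial (Fin (N + 1)) ℂ} {D : ℕ} (hA : A.IsHomogeneous D)
    (h : ∀ w ∈ M.zeroSet ((𝔭 : Ideal _) : Set (MvPolynomial (Fin (N + 1)) ℂ)), M.F A w = 0) : A ∈ 𝔭 := by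
  rw [← M.vanishing_zeroSet_eq_of_isPrime hhom h𝔊 hrel, M.mem_vanishing_iff_of_isHomogeneous hA]
  exact h

include hhom h𝔊 hrel in
/-- **Translation of the vanishing of derivatives along the zero set.** If `Z = Z_G(𝔭)` satisfies
`v + (w - σ) ∈ Z` for all `v, w ∈ Z`, and `∂_{x₀}F_A(σ) = 0` for all forms `A ∈ 𝔭`, then
`∂_{x₀}F_A(w) = 0` for all forms `A ∈ 𝔭` and all `w ∈ Z`. [cite: NesterenkoPhilippon2001, Ch. 11 Prop. 3.8 (Step 2)] -/
theorem lineDeriv_eq_zero_on_zeroSet {σ : V}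
    (hstab : ∀ w ∈ M.zeroSet ((𝔭 : Ideal _) : Set (MvPolynomial (Fin (N + 1)) ℂ)),
      ∀ v ∈ M.zeroSet ((𝔭 : Ideal _) : Set (MvPolynomial (Fin (N + 1)) ℂ)),
        v + (w - σ) ∈ M.zeroSet ((𝔭 : Ideal _) : Set (MvPolynomial (Fin (N + 1)) ℂ)))
    {x₀ : V} (hkill : ∀ A ∈ 𝔭, ∀ D, A.IsHomogeneous D → lineDeriv ℂ (M.F A) σ x₀ = 0)
    {w : V} (hw : w ∈ M.zeroSet ((𝔭 : Ideal _) : Set (MvPolynomial (Fin (N + 1)) ℂ)))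
    {A : MvPolynomial (Fin (N + 1)) ℂ} (hA𝔭 : A ∈ 𝔭) {D : ℕ} (hA : A.IsHomogeneous D) :
    lineDeriv ℂ (M.F A) w x₀ = 0 := by
  set h := w - σ with hh
  obtain ⟨α, hα⟩ := M.exists_lam_ne_zero σ h
  -- the translate `A' = translForm α h A` lies in `𝔭`
  have hA'𝔭 : M.translForm α h A ∈ 𝔭 := by
    refine M.mem_of_forall_F_eq_zero_on_zeroSet hhom h𝔊 hrel (M.isHomogeneous_translForm α h hA) fun v hv => ?_
    rw [M.F_translForm α h hA, M.F_eq_zero_of_mem_of_mem_zeroSet hA𝔭 (hstab w hw v hv), mul_zero]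
  have hk := hkill _ hA'𝔭 _ (M.isHomogeneous_translForm α h hA)
  unfold lineDeriv at hk ⊢
  have hfun : (fun t : ℂ => M.F (M.translForm α h A) (σ + t • x₀)) =
      fun t => (M.lam α (σ + t • x₀) h ^ D) * M.F A (w + t • x₀) := by
    funext t
    rw [M.F_translForm α h hA]
    congr 2
    rw [hh]; abel
  rw [hfun] at hk
  have hg : DifferentiableAt ℂ (fun t : ℂ => M.lam α (σ + t • x₀) h ^ D) 0 := by
    have h1 : AnalyticAt ℂ (fun t : ℂ => ((σ + t • x₀, h) : V × V)) 0 :=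
      (analyticAt_const.add (analyticAt_id.smul analyticAt_const)).prod analyticAt_const
    exact ((((M.analyticOnNhd_lam α) _ trivial).comp h1).pow D).differentiableAt
  have hf : DifferentiableAt ℂ (fun t : ℂ => M.F A (w + t • x₀)) 0 := (M.analyticAt_F_line A w x₀ 0).differentiableAt
  rw [deriv_fun_mul hg hf] at hk
  have hf0 : M.F A (w + (0 : ℂ) • x₀) = 0 := by
    rw [zero_smul, add_zero]; exact M.F_eq_zero_of_mem_of_mem_zeroSet hA𝔭 hw
  rw [hf0, mul_zero, zero_add, zero_smul, add_zero] at hk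
  exact (mul_eq_zero.mp hk).resolve_left (pow_ne_zero D hα)

include hhom h𝔊 hrel in
/-- If `∂_{x₀}F_A` vanishes on `Z` for all forms `A ∈ 𝔭`, then `𝒟_{J,x₀}A ∈ 𝔭`. [folklore] -/
theorem chartDer_mem_of_forall_lineDeriv {x₀ : V}
    (hkillZ : ∀ w ∈ M.zeroSet ((𝔭 : Ideal _) : Set (MvPolynomial (Fin (N + 1)) ℂ)),
      ∀ A ∈ 𝔭, ∀ D, A.IsHomogeneous D → lineDeriv ℂ (M.F A) w x₀ = 0)
    (J : Fin (N + 1)) {A : MvPolynomial (Fin (N + 1)) ℂ} (hA𝔭 : A ∈ 𝔭) {D : ℕ} (hA : A.IsHomogeneous D) :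
    M.chartDer J x₀ A ∈ 𝔭 := by
  refine M.mem_of_forall_F_eq_zero_on_zeroSet hhom h𝔊 hrel (M.isHomogeneous_chartDer J x₀ hA) fun w hw => ?_
  rw [M.F_chartDer J x₀ hA, hkillZ w hw A hA𝔭 D hA, M.F_eq_zero_of_mem_of_mem_zeroSet hA𝔭 hw]
  ring

include hhom h𝔊 hrel in
/-- … hence all iterates `𝒟^k_{J,x₀}A ∈ 𝔭`. [folklore] -/
theorem iterate_chartDer_mem_of_forall_lineDeriv {x₀ : V}
    (hkillZ : ∀ w ∈ M.zeroSet ((𝔭 : Ideal _) : Set (MvPolynomial (Fin (N + 1)) ℂ)),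
      ∀ A ∈ 𝔭, ∀ D, A.IsHomogeneous D → lineDeriv ℂ (M.F A) w x₀ = 0)
    (J : Fin (N + 1)) (k : ℕ) {A : MvPolynomial (Fin (N + 1)) ℂ} (hA𝔭 : A ∈ 𝔭) {D : ℕ} (hA : A.IsHomogeneous D) :
    (M.chartDer J x₀)^[k] A ∈ 𝔭 := by
  induction k with
  | zero => exact hA𝔭
  | succ k ih =>
    rw [Function.iterate_succ_apply']
    exact M.chartDer_mem_of_forall_lineDeriv hhom h𝔊 hrel hkillZ J ih (M.isHomogeneous_iterate_chartDer J x₀ k hA)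

include hhom h𝔊 hrel in
/-- **A direction killing all derivatives of `𝔭` along `Z` lies in the lineality space of `Z`.**
[cite: NesterenkoPhilippon2001, Ch. 11 Prop. 3.8 (Step 2)] -/
theorem mem_linSpace_of_forall_lineDeriv {x₀ : V}
    (hkillZ : ∀ w ∈ M.zeroSet ((𝔭 : Ideal _) : Set (MvPolynomial (Fin (N + 1)) ℂ)),
      ∀ A ∈ 𝔭, ∀ D, A.IsHomogeneous D → lineDeriv ℂ (M.F A) w x₀ = 0) :
    x₀ ∈ linSpace (M.zeroSet ((𝔭 : Ideal _) : Set (MvPolynomial (Fin (N + 1)) ℂ))) := by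
  intro v hv t
  rw [M.mem_zeroSet_iff_forall_isHomogeneous hhom]
  intro A hA𝔭 D hA
  obtain ⟨J, hJ⟩ := M.exists_Θ_ne_zero v
  have hall : ∀ k, M.F ((M.chartDer J x₀)^[k] A) v = 0 := fun k =>
    M.F_eq_zero_of_mem_of_mem_zeroSet (M.iterate_chartDer_mem_of_forall_lineDeriv hhom h𝔊 hrel hkillZ J k hA𝔭 hA) hv
  set φ : ℂ → ℂ := fun t => M.F A (v + t • x₀) / M.Θ J (v + t • x₀) ^ D with hφdef
  have hφ : ∀ k, iteratedDeriv k φ 0 = 0 := fun k => by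
    have := hall k
    rw [M.F_chartDer_iterate J x₀ hA k hJ] at this
    exact (mul_eq_zero.mp this).resolve_left (pow_ne_zero _ hJ)
  have hΘline : AnalyticAt ℂ (fun t : ℂ => M.Θ J (v + t • x₀)) 0 := by
    have := M.analyticAt_F_line (X J) v x₀ 0
    simpa using this
  have hφan : AnalyticAt ℂ φ 0 :=
    (M.analyticAt_F_line A v x₀ 0).div (hΘline.pow D) (by simpa using pow_ne_zero D hJ)
  -- `φ` vanishes near `0`
  have hφ0 : ∀ᶠ t in 𝓝 (0 : ℂ), φ t = 0 := by
    rw [← analyticOrderAt_eq_top, ENat.eq_top_iff_forall_ge]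
    intro n
    exact (natCast_le_analyticOrderAt_iff_iteratedDeriv_eq_zero hφan).mpr fun k _ => hφ k
  -- hence `F_A(v + t x₀)` vanishes near `0`, hence everywhere
  have hFA0 : ∀ᶠ t in 𝓝 (0 : ℂ), M.F A (v + t • x₀) = 0 := by
    have hΘnz : ∀ᶠ t in 𝓝 (0 : ℂ), M.Θ J (v + t • x₀) ≠ 0 :=
      hΘline.continuousAt.eventually_ne (by simpa using hJ)
    filter_upwards [hφ0, hΘnz] with t ht hΘt
    have : φ t * M.Θ J (v + t • x₀) ^ D = M.F A (v + t • x₀) := div_mul_cancel₀ _ (pow_ne_zero D hΘt)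
    rw [← this, ht, zero_mul]
  have hent : AnalyticOnNhd ℂ (fun t : ℂ => M.F A (v + t • x₀)) univ := fun t _ => M.analyticAt_F_line A v x₀ t
  have hzero := hent.eqOn_zero_of_preconnected_of_eventuallyEq_zero isPreconnected_univ (mem_univ 0) hFA0
  exact hzero (mem_univ t)

/-! ### The transversal family -/

include hhom h𝔊 hrel in
/-- **Roy's Prop. 3.8, Step 2 (transversal family).** With `Z = Z_G(𝔭)` stable under the
differences of its points, `σ ∈ Z` in the chart `Θ_{J₀} ≠ 0`, and linearly independent
`x_1, …, x_s` spanning a space transversal to the lineality space `𝒯(Z)`, there are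
`G_1, …, G_s ∈ 𝔭` with `𝒟_{x_i}G_j ∈ 𝔭` (`i ≠ j`) and `𝒟_{x_i}G_i ∉ 𝔭`.
[cite: NesterenkoPhilippon2001, Ch. 11 Prop. 3.8 (Step 2), (94)] -/
theorem exists_transversal {σ : V} (hσ : σ ∈ M.zeroSet ((𝔭 : Ideal _) : Set (MvPolynomial (Fin (N + 1)) ℂ)))
    {J₀ : Fin (N + 1)} (hΘσ : M.Θ J₀ σ ≠ 0)
    (hstab : ∀ w ∈ M.zeroSet ((𝔭 : Ideal _) : Set (MvPolynomial (Fin (N + 1)) ℂ)),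
      ∀ v ∈ M.zeroSet ((𝔭 : Ideal _) : Set (MvPolynomial (Fin (N + 1)) ℂ)),
        v + (w - σ) ∈ M.zeroSet ((𝔭 : Ideal _) : Set (MvPolynomial (Fin (N + 1)) ℂ)))
    {s : ℕ} {x : Fin s → V} (hx : LinearIndependent ℂ x)
    (htrans : Submodule.span ℂ (Set.range x) ⊓ linSpace (M.zeroSet ((𝔭 : Ideal _) : Set (MvPolynomial (Fin (N + 1)) ℂ))) = ⊥) :
    ∃ G : Fin s → MvPolynomial (Fin (N + 1)) ℂ, (∀ i, G i ∈ 𝔭) ∧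
      (∀ i j, i ≠ j → M.chartDer J₀ (x i) (G j) ∈ 𝔭) ∧ ∀ i, M.chartDer J₀ (x i) (G i) ∉ 𝔭 := by
  classical
  -- the vectors `Ψ A = (F_{𝒟_{x_i} A}(σ))_i`
  set Ψ : MvPolynomial (Fin (N + 1)) ℂ → (Fin s → ℂ) := fun A i => M.F (M.chartDer J₀ (x i) A) σ with hΨ
  set T₀ : Set (Fin s → ℂ) := {u | ∃ A ∈ 𝔭, (∃ D, A.IsHomogeneous D) ∧ u = Ψ A} with hT₀
  -- they span `ℂ^s`
  have hspan : Submodule.span ℂ T₀ = ⊤ := by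
    by_contra hne
    obtain ⟨f, hf0, hfker⟩ := Submodule.exists_le_ker_of_lt_top _ (lt_top_iff_ne_top.mpr hne)
    set lam : Fin s → ℂ := fun i => f (Pi.single i 1) with hlam
    have hfapply : ∀ u : Fin s → ℂ, f u = ∑ i, u i * lam i := by
      intro u
      conv_lhs => rw [show u = ∑ i, u i • (Pi.single i (1 : ℂ) : Fin s → ℂ) by
        ext j; simp [Finset.sum_apply, Pi.single_apply]]
      rw [map_sum]
      exact Finset.sum_congr rfl fun i _ => by rw [map_smul, smul_eq_mul]
    set x₀ : V := ∑ i, lam i • x i with hx₀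
    -- `x₀` kills the derivatives of the forms of `𝔭` at `σ`
    have hkill : ∀ A ∈ 𝔭, ∀ D, A.IsHomogeneous D → lineDeriv ℂ (M.F A) σ x₀ = 0 := by
      intro A hA𝔭 D hA
      have h1 : M.F (M.chartDer J₀ x₀ A) σ = 0 := by
        rw [hx₀, M.F_chartDer_sum_smul J₀ Finset.univ lam x hA σ]
        have : f (Ψ A) = 0 := LinearMap.mem_ker.mp (hfker (Submodule.subset_span ⟨A, hA𝔭, ⟨D, hA⟩, rfl⟩))
        rw [hfapply] at this
        rw [← this]
        exact Finset.sum_congr rfl fun i _ => mul_comm _ _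
      rw [M.F_chartDer J₀ x₀ hA, M.F_eq_zero_of_mem_of_mem_zeroSet hA𝔭 hσ] at h1
      have : M.Θ J₀ σ * lineDeriv ℂ (M.F A) σ x₀ = 0 := by simpa using h1
      exact (mul_eq_zero.mp this).resolve_left hΘσ
    have hkillZ : ∀ w ∈ M.zeroSet ((𝔭 : Ideal _) : Set (MvPolynomial (Fin (N + 1)) ℂ)),
        ∀ A ∈ 𝔭, ∀ D, A.IsHomogeneous D → lineDeriv ℂ (M.F A) w x₀ = 0 :=
      fun w hw A hA𝔭 D hA => M.lineDeriv_eq_zero_on_zeroSet hhom h𝔊 hrel hstab hkill hw hA𝔭 hA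
    have hx₀lin : x₀ ∈ linSpace (M.zeroSet ((𝔭 : Ideal _) : Set (MvPolynomial (Fin (N + 1)) ℂ))) :=
      M.mem_linSpace_of_forall_lineDeriv hhom h𝔊 hrel hkillZ
    have hx₀span : x₀ ∈ Submodule.span ℂ (Set.range x) :=
      Submodule.sum_mem _ fun i _ => Submodule.smul_mem _ _ (Submodule.subset_span ⟨i, rfl⟩)
    have hx₀0 : x₀ = 0 := by
      have : x₀ ∈ Submodule.span ℂ (Set.range x) ⊓ linSpace _ := ⟨hx₀span, hx₀lin⟩
      rw [htrans] at this
      exact (Submodule.mem_bot ℂ).mp this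
    have hlam0 : ∀ i, lam i = 0 := fun i => Fintype.linearIndependent_iff.mp hx lam (by rw [← hx₀]; exact hx₀0) i
    apply hf0
    apply LinearMap.ext
    intro u
    rw [hfapply, LinearMap.zero_apply]
    exact Finset.sum_eq_zero fun i _ => by rw [hlam0 i, mul_zero]
  -- extract a basis of `ℂ^s` inside `T₀`
  obtain ⟨b, hbT, hbspan, hbli⟩ := exists_linearIndependent ℂ T₀
  rw [hspan] at hbspan
  have hbfin : b.Finite := hbli.setFinite
  haveI : Fintype b := hbfin.fintype
  have hcard : Fintype.card b = s := by
    have h1 := finrank_span_eq_card hbli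
    rw [Subtype.range_coe_subtype, setOf_mem_eq, hbspan, finrank_top] at h1
    simpa using h1.symm
  set e : Fin s ≃ b := (Fintype.equivFinOfCardEq hcard).symm with he
  have hchoose : ∀ j : Fin s, ∃ A : MvPolynomial (Fin (N + 1)) ℂ, A ∈ 𝔭 ∧ Ψ A = (e j : Fin s → ℂ) := by
    intro j
    obtain ⟨A, hA𝔭, -, hAu⟩ := hbT (e j).2
    exact ⟨A, hA𝔭, hAu.symm⟩
  choose A hA𝔭 hAΨ using hchoose
  -- the matrix `Mat j i = F_{𝒟_{x_i} A_j}(σ)` is invertible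
  set Mat : Matrix (Fin s) (Fin s) ℂ := fun j i => Ψ (A j) i with hMat
  have hrows : LinearIndependent ℂ (fun j => Mat j) := by
    have : (fun j => Mat j) = (fun j => ((e j : b) : Fin s → ℂ)) := by
      funext j; rw [hMat]; simp only; rw [hAΨ j]
    rw [this]
    exact hbli.comp e e.injective
  have hdetMat : Mat.det ≠ 0 := by
    have hu : IsUnit Mat := (Matrix.linearIndependent_rows_iff_isUnit).mp hrows
    exact ((Matrix.isUnit_iff_isUnit_det Mat).mp hu).ne_zero
  -- the matrix of forms `𝕄 j i = 𝒟_{x_i} A_j` and the cofactor construction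
  set 𝕄 : Matrix (Fin s) (Fin s) (MvPolynomial (Fin (N + 1)) ℂ) := fun j i => M.chartDer J₀ (x i) (A j) with h𝕄
  have hF𝕄 : 𝕄.map (fun P => M.F P σ) = Mat := by
    ext j i; rfl
  have hdet𝔭 : 𝕄.det ∉ 𝔭 := by
    intro hmem
    have h0 := M.F_eq_zero_of_mem_of_mem_zeroSet hmem hσ
    have : M.F 𝕄.det σ = Mat.det := by
      rw [← hF𝕄, F]
      exact (RingHom.map_det (eval (M.pt σ)) 𝕄)
    rw [this] at h0
    exact hdetMat h0
  set G : Fin s → MvPolynomial (Fin (N + 1)) ℂ := fun k => ∑ j, 𝕄.adjugate k j * A j with hG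
  have hG𝔭 : ∀ k, G k ∈ 𝔭 := fun k => Submodule.sum_mem _ fun j _ => Ideal.mul_mem_left _ _ (hA𝔭 j)
  -- `𝒟_{x_i} G_k ≡ δ_{ki} det 𝕄 (mod 𝔭)`
  have hkey : ∀ i k, M.chartDer J₀ (x i) (G k) - (if k = i then 𝕄.det else 0) ∈ 𝔭 := by
    intro i k
    have hadj : ∑ j, 𝕄.adjugate k j * 𝕄 j i = if k = i then 𝕄.det else 0 := by
      have := congrFun (congrFun (Matrix.adjugate_mul 𝕄) k) i
      rw [Matrix.mul_apply, Matrix.smul_apply, Matrix.one_apply, smul_eq_mul, mul_ite, mul_one, mul_zero] at this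
      exact this
    have hexp : M.chartDer J₀ (x i) (G k) =
        ∑ j, M.chartDer J₀ (x i) (𝕄.adjugate k j) * A j + ∑ j, 𝕄.adjugate k j * 𝕄 j i := by
      rw [hG]
      simp only [map_sum, Derivation.leibniz, smul_eq_mul]
      rw [← Finset.sum_add_distrib]
      refine Finset.sum_congr rfl fun j _ => ?_
      rw [h𝕄]
      ring
    rw [hexp, hadj, add_sub_cancel_right]
    exact Submodule.sum_mem _ fun j _ => Ideal.mul_mem_left _ _ (hA𝔭 j)
  refine ⟨G, hG𝔭, fun i j hij => ?_, fun i => ?_⟩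
  · have h := hkey i j
    rwa [if_neg (Ne.symm hij), sub_zero] at h
  · intro hmem
    have h := hkey i i
    rw [if_pos rfl] at h
    exact hdet𝔭 (by simpa using Ideal.sub_mem _ hmem h)

end Step2

end AnalyticGroupModel

end Literature.NumberTheory.Transcendental
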